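import Summits.MatrixMultiplication.OmegaCensus.STPPVosperSlackOneA2CoverRows

/-!
# ω-census (abelian STPP census): case-α₂ cover table for `(2,4,4)² ⊆ ℤ₆₁`, rows `0 ≤ j < 6` and `7 ≤ j < 30` (kernel computation)

HONEST FRAMING (pub-omega census; verbatim): lottery ticket; floor = certified bounds/negative ranges.
Census STRUCTURE (seat pub-omega-stpp-1 gen 31, 2026-08-28), family (b2).  One chunk of the row table
`a2CoverRow 61 50 16 4 {0, ±1, ±2, ±3} 8 [(2,4,4)]` (`STPPVosperSlackOneA2CoverRows.lean`) for the pattern `{(2,4,4),(2,4,4)}` at `61` in the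
reading `(a,b,c) = (2,4,4)` (block `0`; `z = 8`, `L = 16`, `n + 1 = 50`), split by the step `j` so that each `decide +kernel` stays small; the two rows
carrying a surviving window configuration (`j = 6`, `j = 55`, ratio `±6`) run the exact-cover search and sit in their own files.  Assembled in
`STPPVosperSlackOneCoverKillsZ61.lean`.  Pure finite computation; nothing here is progress on `ω`.  Python mirror: HOME
`pub-omega-stpp-1-g31/code/pilot_slack1_cover.py` / `cover_mirror_z.py`.
-/

open Finset

namespace Summit.MatrixMultiplication.OmegaCensus.CubeNB

set_option maxHeartbeats 4000000 in
/-- Rows `0 ≤ j < 6` of `a2CoverRow 61 50 16 4 {0, ±1, ±2, ±3} 8 [(2,4,4)]`. [folklore] -/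
theorem a2CoverRow_61_244_rows_0_6 :
    ((List.range' 0 6).all (a2CoverRow 61 50 16 4 {0, 1, 60, 2, 59, 3, 58} 8 [(2, 4, 4)])) = true := by
  decide +kernel

set_option maxHeartbeats 4000000 in
/-- Rows `7 ≤ j < 30` of `a2CoverRow 61 50 16 4 {0, ±1, ±2, ±3} 8 [(2,4,4)]`. [folklore] -/
theorem a2CoverRow_61_244_rows_7_30 :
    ((List.range' 7 23).all (a2CoverRow 61 50 16 4 {0, 1, 60, 2, 59, 3, 58} 8 [(2, 4, 4)])) = true := by
  decide +kernel

end Summit.MatrixMultiplication.OmegaCensus.CubeNB
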